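import Mathlib
import HarnessLib
import Summits.Parity.GeneralizedHardyLittlewood.Theses.LiouvilleShiftedTables

/-!
# `DilatedTableChowla` (stmt-Parity-14271): the crux factored into blocks — base bookkeeping

Negative-lemma infrastructure for the crux `LiouvilleShiftedTables.DilatedTableChowla`
(route LiouvilleShiftedTables, X1; cdisprove seat), landed from the crux work file
`Cruxes/DilatedTableChowla/Disproof.lean` (§0, §1, §3, §5, §11 there) so that skeletons, ideators
and provers can IMPORT it instead of copying.  The crux reads: for every `c ≠ 0`,
`0 < δ ≤ 1/12`, `C > 0`, all large `x`, uniformly for `x^δ ≤ A ≤ x^{1/3+δ}` and all class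
functions `u v : ℕ → ℕ`,
`Σ_{q ≤ x^{δ/2}} q³ · Σ_{a,a' ∈ (A,2A], a ≡ a' ≡ u q (q)} (Σ_{b ≤ x/A, b ≡ v q (q)} λ(ab+c)λ(a'b+c))²
≤ x²/(log x)^C`.

* `L`, `rows`, `cols`, `S` (two-row correlation = Gram entry of the block `M Mᵀ`), `F` (block
  fourth moment `tr (M Mᵀ)²`), `lhs`, and the READ-BACK
  `crux_iff_lhs : DilatedTableChowla ↔ ∀ … lhs ≤ x²/(log x)^C` (`Iff.rfl`).
* Entries: `L` is `±1` on positive arguments and `0` otherwise (`Int.toNat` truncation), complete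
  multiplicativity; the trivial bounds `|S| ≤ #cols`, `F ≤ #rows² · #cols²`; the diagonal minorant
  `#rows · #cols² ≤ F` for `c ≥ 0` (no cancellation on `a = a'`); `term_le_lhs`, `F_one_le_lhs`;
  `rows_one`, `cols_one`, `F_one_eq_table` (the `q = 1` block is the plain table of `TableChowla`).
* Class counts in intervals: `card_modEq_Ioc_bounds`, `card_rows_bounds`, `card_cols_bounds`.
* `crux_imp_pointwise_markov`: by Markov's inequality the `ℓ¹`-over-dilations form forces, for
  every `K > 0`, the POINTWISE bound `q⁴ F(q,u q,v q) ≤ K x²/(log x)^C` off a set of dilations of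
  harmonic mass `≤ 1/K`. [folklore]
-/

namespace Summit.Parity.GeneralizedHardyLittlewood.Theorems.DilatedTableChowla.Negative

open Summit.Parity.GeneralizedHardyLittlewood.Theses.LiouvilleShiftedTables
open Finset

/-! ## §0 The crux, factored -/

/-- The entry function of the crux: `L n = λ(n.toNat)` as a real number (`L n = 0` for `n ≤ 0`,
since `ArithmeticFunction`s vanish at `0`). -/
noncomputable def L (n : ℤ) : ℝ := (ArithmeticFunction.liouville (Int.toNat n) : ℝ)

/-- Rows of the `(q;u)`-table at scale `A`: `a ∈ (⌊A⌋, ⌊2A⌋]`, `a ≡ u (mod q)`. -/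
noncomputable def rows (A : ℝ) (q u : ℕ) : Finset ℕ :=
  (Finset.Ioc ⌊A⌋₊ ⌊2 * A⌋₊).filter (fun a : ℕ => a ≡ u [MOD q])

/-- Columns: `b ∈ [1, ⌊x/A⌋]`, `b ≡ v (mod q)`. -/
noncomputable def cols (x A : ℝ) (q v : ℕ) : Finset ℕ :=
  (Finset.Icc 1 ⌊x / A⌋₊).filter (fun b : ℕ => b ≡ v [MOD q])

/-- The two-row correlation `S(a,a') = Σ_{b ∈ cols} λ(ab+c) λ(a'b+c)` (an entry of `M Mᵀ`). -/
noncomputable def S (c : ℤ) (x A : ℝ) (q v a a' : ℕ) : ℝ :=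
  ∑ b ∈ cols x A q v, L ((a : ℤ) * b + c) * L ((a' : ℤ) * b + c)

/-- The fourth moment `F(q,u,v) = tr (M Mᵀ)² = Σ_{a,a' ∈ rows} S(a,a')²`. -/
noncomputable def F (c : ℤ) (x A : ℝ) (q u v : ℕ) : ℝ :=
  ∑ a ∈ rows A q u, ∑ a' ∈ rows A q u, (S c x A q v a a') ^ 2

/-- The left-hand side of the crux: `Σ_{1 ≤ q ≤ ⌊x^{δ/2}⌋} q³ · F(q, u q, v q)`. -/
noncomputable def lhs (c : ℤ) (δ x A : ℝ) (u v : ℕ → ℕ) : ℝ :=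
  ∑ q ∈ Finset.Icc 1 ⌊x ^ (δ / 2)⌋₊, (q : ℝ) ^ 3 * F c x A q (u q) (v q)

/-- The crux, verbatim, in the factored notation (definitional: `Iff.rfl`). -/
theorem crux_iff_lhs : DilatedTableChowla ↔
    ∀ c : ℤ, c ≠ 0 → ∀ δ : ℝ, 0 < δ → δ ≤ 1 / 12 → ∀ C : ℝ, 0 < C → ∃ x₀ : ℝ, ∀ x : ℝ, x₀ ≤ x →
      ∀ A : ℝ, x ^ δ ≤ A → A ≤ x ^ (1 / 3 + δ) → ∀ u v : ℕ → ℕ,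
        lhs c δ x A u v ≤ x ^ 2 / Real.log x ^ C :=
  Iff.rfl

/-! ## §1 Elementary facts about the entries and the pieces -/

/-- A positive integer has nonzero `toNat`. -/
theorem toNat_ne_zero_of_pos {n : ℤ} (hn : 0 < n) : n.toNat ≠ 0 := by
  omega

/-- On positive arguments `L n = (-1)^{Ω(n)}`. -/
theorem L_of_pos {n : ℤ} (hn : 0 < n) :
    L n = (-1 : ℝ) ^ (ArithmeticFunction.cardFactors n.toNat) := by
  unfold L
  rw [ArithmeticFunction.liouville_apply (toNat_ne_zero_of_pos hn)]
  push_cast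
  rfl

/-- On positive arguments `L n ^ 2 = 1`. -/
theorem L_sq_of_pos {n : ℤ} (hn : 0 < n) : L n ^ 2 = 1 := by
  rw [L_of_pos hn, ← pow_mul, mul_comm, pow_mul]
  norm_num

/-- On positive arguments `L n * L n = 1`. -/
theorem L_mul_self_of_pos {n : ℤ} (hn : 0 < n) : L n * L n = 1 := by
  rw [← sq]; exact L_sq_of_pos hn

/-- On nonpositive arguments `L n = 0` (truncation by `Int.toNat`). -/
theorem L_nonpos_arg {n : ℤ} (hn : n ≤ 0) : L n = 0 := by
  unfold L
  have : n.toNat = 0 := by omega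
  rw [this]; simp

/-- `|L n| ≤ 1` for every integer `n`. -/
theorem abs_L_le_one (n : ℤ) : |L n| ≤ 1 := by
  rcases le_or_gt n 0 with h | h
  · rw [L_nonpos_arg h]; simp
  · rw [L_of_pos h]; simp

/-- `L` on a natural number is the Liouville function. -/
theorem L_natCast (n : ℕ) : L (n : ℤ) = (ArithmeticFunction.liouville n : ℝ) := by
  unfold L; rw [Int.toNat_natCast]

/-- Complete multiplicativity on naturals: `λ(mn) = λ(m) λ(n)`. -/
theorem L_natCast_mul (m n : ℕ) : L ((m : ℤ) * n) = L m * L n := by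
  rw [show ((m : ℤ) * n) = ((m * n : ℕ) : ℤ) by push_cast; ring, L_natCast, L_natCast, L_natCast,
    ArithmeticFunction.liouville_apply_mul]
  push_cast; ring

/-- Membership in `rows`: the dyadic interval and the class condition. -/
theorem mem_rows {A : ℝ} {q u a : ℕ} :
    a ∈ rows A q u ↔ (⌊A⌋₊ < a ∧ a ≤ ⌊2 * A⌋₊) ∧ a ≡ u [MOD q] := by
  simp [rows, Finset.mem_filter, Finset.mem_Ioc]

/-- Membership in `cols`: `1 ≤ b ≤ ⌊x/A⌋` and the class condition. -/
theorem mem_cols {x A : ℝ} {q v b : ℕ} :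
    b ∈ cols x A q v ↔ (1 ≤ b ∧ b ≤ ⌊x / A⌋₊) ∧ b ≡ v [MOD q] := by
  simp [cols, Finset.mem_filter, Finset.mem_Icc]

/-- Rows are positive naturals. -/
theorem one_le_of_mem_rows {A : ℝ} {q u a : ℕ} (h : a ∈ rows A q u) : 1 ≤ a := by
  rw [mem_rows] at h; omega

/-- Columns are positive naturals. -/
theorem one_le_of_mem_cols {x A : ℝ} {q v b : ℕ} (h : b ∈ cols x A q v) : 1 ≤ b := by
  rw [mem_cols] at h; exact h.1.1

/-- `|S(a,a')| ≤ #cols` for every shift. -/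
theorem abs_S_le (c : ℤ) (x A : ℝ) (q v a a' : ℕ) :
    |S c x A q v a a'| ≤ ((cols x A q v).card : ℝ) := by
  unfold S
  calc |∑ b ∈ cols x A q v, L ((a : ℤ) * b + c) * L ((a' : ℤ) * b + c)|
        ≤ ∑ b ∈ cols x A q v, |L ((a : ℤ) * b + c) * L ((a' : ℤ) * b + c)| :=
          Finset.abs_sum_le_sum_abs _ _
    _ ≤ ∑ b ∈ cols x A q v, (1 : ℝ) := by
          refine Finset.sum_le_sum fun b _ => ?_
          rw [abs_mul]
          have h1 := abs_L_le_one ((a : ℤ) * b + c)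
          have h2 := abs_L_le_one ((a' : ℤ) * b + c)
          have h3 := abs_nonneg (L ((a : ℤ) * b + c))
          nlinarith
    _ = ((cols x A q v).card : ℝ) := by simp

/-- `S(a,a')² ≤ #cols²`. -/
theorem S_sq_le (c : ℤ) (x A : ℝ) (q v a a' : ℕ) :
    (S c x A q v a a') ^ 2 ≤ ((cols x A q v).card : ℝ) ^ 2 := by
  have h := abs_S_le c x A q v a a'
  have h0 : 0 ≤ |S c x A q v a a'| := abs_nonneg _
  calc (S c x A q v a a') ^ 2 = |S c x A q v a a'| ^ 2 := (sq_abs _).symm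
    _ ≤ ((cols x A q v).card : ℝ) ^ 2 := by gcongr

/-- On the diagonal there is never cancellation: `S(a,a) = #cols` as soon as every entry
`ab + c` is positive (automatic for `c ≥ 0`; for `c < 0` as soon as `a > |c|`). -/
theorem S_self {c : ℤ} {x A : ℝ} {q v a : ℕ} (h : ∀ b ∈ cols x A q v, 0 < (a : ℤ) * b + c) :
    S c x A q v a a = ((cols x A q v).card : ℝ) := by
  unfold S
  rw [Finset.sum_congr rfl fun b hb => L_mul_self_of_pos (h b hb)]
  simp

/-- For `c ≥ 0` and `a ≥ 1` the diagonal correlation is `S(a,a) = #cols`. -/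
theorem S_self_of_nonneg {c : ℤ} (hc : 0 ≤ c) (x A : ℝ) (q v : ℕ) {a : ℕ} (ha : 1 ≤ a) :
    S c x A q v a a = ((cols x A q v).card : ℝ) := by
  refine S_self fun b hb => ?_
  have hb1 : (1 : ℤ) ≤ b := by exact_mod_cast one_le_of_mem_cols hb
  have ha1 : (1 : ℤ) ≤ a := by exact_mod_cast ha
  nlinarith

/-- The fourth moment is a sum of squares. -/
theorem F_nonneg (c : ℤ) (x A : ℝ) (q u v : ℕ) : 0 ≤ F c x A q u v :=
  Finset.sum_nonneg fun _ _ => Finset.sum_nonneg fun _ _ => sq_nonneg _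

/-- Each weighted term `q³ F(q,u,v)` is nonnegative. -/
theorem term_nonneg (c : ℤ) (x A : ℝ) (q u v : ℕ) : 0 ≤ (q : ℝ) ^ 3 * F c x A q u v :=
  mul_nonneg (by positivity) (F_nonneg c x A q u v)

/-- The left-hand side of the crux is nonnegative. -/
theorem lhs_nonneg (c : ℤ) (δ x A : ℝ) (u v : ℕ → ℕ) : 0 ≤ lhs c δ x A u v :=
  Finset.sum_nonneg fun q _ => term_nonneg c x A q (u q) (v q)

/-- A single dilation minorises the left side (all terms are nonnegative). -/
theorem term_le_lhs (c : ℤ) (δ x A : ℝ) (u v : ℕ → ℕ) {q₀ : ℕ} (h1 : 1 ≤ q₀)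
    (h2 : q₀ ≤ ⌊x ^ (δ / 2)⌋₊) :
    (q₀ : ℝ) ^ 3 * F c x A q₀ (u q₀) (v q₀) ≤ lhs c δ x A u v := by
  unfold lhs
  exact Finset.single_le_sum (f := fun q : ℕ => (q : ℝ) ^ 3 * F c x A q (u q) (v q))
    (fun q _ => term_nonneg c x A q (u q) (v q)) (Finset.mem_Icc.2 ⟨h1, h2⟩)

/-- The `q = 1` table minorises the left side as soon as `x ≥ 1`. -/
theorem F_one_le_lhs (c : ℤ) {δ x : ℝ} (hδ : 0 ≤ δ) (hx : 1 ≤ x) (A : ℝ) (u v : ℕ → ℕ) :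
    F c x A 1 (u 1) (v 1) ≤ lhs c δ x A u v := by
  have h : (1 : ℕ) ≤ ⌊x ^ (δ / 2)⌋₊ := by
    apply Nat.le_floor
    simpa using Real.one_le_rpow hx (by linarith : 0 ≤ δ / 2)
  simpa using term_le_lhs c δ x A u v le_rfl h

/-- The diagonal minorises the fourth moment. -/
theorem diag_le_F (c : ℤ) (x A : ℝ) (q u v : ℕ) :
    ∑ a ∈ rows A q u, (S c x A q v a a) ^ 2 ≤ F c x A q u v := by
  unfold F
  refine Finset.sum_le_sum fun a ha => ?_
  exact Finset.single_le_sum (f := fun a' => (S c x A q v a a') ^ 2) (fun _ _ => sq_nonneg _) ha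

/-- For `c ≥ 0` the diagonal is exactly `#rows · #cols²`. -/
theorem diag_eq_of_nonneg {c : ℤ} (hc : 0 ≤ c) (x A : ℝ) (q u v : ℕ) :
    ∑ a ∈ rows A q u, (S c x A q v a a) ^ 2
      = ((rows A q u).card : ℝ) * ((cols x A q v).card : ℝ) ^ 2 := by
  rw [Finset.sum_congr rfl fun a ha => by rw [S_self_of_nonneg hc x A q v (one_le_of_mem_rows ha)]]
  simp

/-- For `c ≥ 0` the diagonal `#rows · #cols²` minorises `F`. -/
theorem rows_mul_cols_sq_le_F {c : ℤ} (hc : 0 ≤ c) (x A : ℝ) (q u v : ℕ) :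
    ((rows A q u).card : ℝ) * ((cols x A q v).card : ℝ) ^ 2 ≤ F c x A q u v := by
  rw [← diag_eq_of_nonneg hc]; exact diag_le_F c x A q u v

/-- Trivial bound: `F ≤ #rows² #cols²`. -/
theorem F_le_trivial (c : ℤ) (x A : ℝ) (q u v : ℕ) :
    F c x A q u v ≤ ((rows A q u).card : ℝ) ^ 2 * ((cols x A q v).card : ℝ) ^ 2 := by
  unfold F
  calc ∑ a ∈ rows A q u, ∑ a' ∈ rows A q u, (S c x A q v a a') ^ 2
        ≤ ∑ a ∈ rows A q u, ∑ a' ∈ rows A q u, ((cols x A q v).card : ℝ) ^ 2 :=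
          Finset.sum_le_sum fun a _ => Finset.sum_le_sum fun a' _ => S_sq_le c x A q v a a'
    _ = _ := by simp; ring

/-- `q = 1`: no congruence restriction. -/
theorem rows_one (A : ℝ) (u : ℕ) : rows A 1 u = Finset.Ioc ⌊A⌋₊ ⌊2 * A⌋₊ := by
  unfold rows; exact Finset.filter_true_of_mem fun a _ => Nat.modEq_one

/-- `q = 1`: the column class condition is vacuous. -/
theorem cols_one (x A : ℝ) (v : ℕ) : cols x A 1 v = Finset.Icc 1 ⌊x / A⌋₊ := by
  unfold cols; exact Finset.filter_true_of_mem fun b _ => Nat.modEq_one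


/-! ## Class counts in intervals -/

/-- Two-sided real bounds for the number of `n ∈ (L, M]` in a residue class mod `q`. -/
theorem card_modEq_Ioc_bounds (L M q v : ℕ) (hq : 0 < q) (hLM : L ≤ M) :
    ((M : ℝ) - L) / q - 1 ≤ (((Finset.Ioc L M).filter (fun n : ℕ => n ≡ v [MOD q])).card : ℝ) ∧
    (((Finset.Ioc L M).filter (fun n : ℕ => n ≡ v [MOD q])).card : ℝ) ≤ ((M : ℝ) - L) / q + 1 := by
  have h := Nat.Ioc_filter_modEq_card L M hq v
  set k := ((Finset.Ioc L M).filter (fun n : ℕ => n ≡ v [MOD q])).card with hk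
  have hq' : (0 : ℚ) < q := by exact_mod_cast hq
  have hB1 := Int.floor_le (((M : ℚ) - v) / q)
  have hB2 := Int.lt_floor_add_one (((M : ℚ) - v) / q)
  have hA1 := Int.floor_le (((L : ℚ) - v) / q)
  have hA2 := Int.lt_floor_add_one (((L : ℚ) - v) / q)
  have hdiff : ((M : ℚ) - v) / q - ((L : ℚ) - v) / q = ((M : ℚ) - L) / q := by
    field_simp; ring
  have hLM' : (0 : ℚ) ≤ ((M : ℚ) - L) / q := by
    apply div_nonneg _ hq'.le
    have : (L : ℚ) ≤ M := by exact_mod_cast hLM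
    linarith
  -- work in ℚ, then cast
  have hkQ : ((M : ℚ) - L) / q - 1 ≤ (k : ℚ) ∧ (k : ℚ) ≤ ((M : ℚ) - L) / q + 1 := by
    have hkZ : (k : ℤ) = max (⌊((M : ℚ) - v) / q⌋ - ⌊((L : ℚ) - v) / q⌋) 0 := h
    constructor
    · have : (⌊((M : ℚ) - v) / q⌋ : ℚ) - ⌊((L : ℚ) - v) / q⌋ ≤ (k : ℚ) := by
        have : ⌊((M : ℚ) - v) / q⌋ - ⌊((L : ℚ) - v) / q⌋ ≤ (k : ℤ) := by
          rw [hkZ]; exact le_max_left _ _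
        exact_mod_cast this
      linarith
    · rcases le_or_gt (⌊((M : ℚ) - v) / q⌋ - ⌊((L : ℚ) - v) / q⌋) 0 with hle | hgt
      · have : (k : ℤ) = 0 := by rw [hkZ]; exact max_eq_right hle
        have hk0 : (k : ℚ) = 0 := by exact_mod_cast this
        rw [hk0]; linarith
      · have : (k : ℤ) = ⌊((M : ℚ) - v) / q⌋ - ⌊((L : ℚ) - v) / q⌋ := by
          rw [hkZ]; exact max_eq_left hgt.le
        have hk1 : (k : ℚ) = (⌊((M : ℚ) - v) / q⌋ : ℚ) - ⌊((L : ℚ) - v) / q⌋ := by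
          exact_mod_cast this
        rw [hk1]; linarith
  constructor
  · have := (Rat.cast_le (K := ℝ)).2 hkQ.1
    push_cast at this
    exact this
  · have := (Rat.cast_le (K := ℝ)).2 hkQ.2
    push_cast at this
    exact this

/-- `(⌊2A⌋ − ⌊A⌋)/q − 1 ≤ #rows ≤ (⌊2A⌋ − ⌊A⌋)/q + 1`. -/
theorem card_rows_bounds (A : ℝ) (hA : 0 ≤ A) (q u : ℕ) (hq : 0 < q) :
    ((⌊2 * A⌋₊ : ℝ) - ⌊A⌋₊) / q - 1 ≤ ((rows A q u).card : ℝ) ∧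
      ((rows A q u).card : ℝ) ≤ ((⌊2 * A⌋₊ : ℝ) - ⌊A⌋₊) / q + 1 := by
  unfold rows
  exact card_modEq_Ioc_bounds _ _ q u hq (Nat.floor_le_floor (by linarith))

/-- `cols` as a filtered `Ioc 0 ⌊x/A⌋`. -/
theorem cols_eq_Ioc (x A : ℝ) (q v : ℕ) :
    cols x A q v = (Finset.Ioc 0 ⌊x / A⌋₊).filter (fun b : ℕ => b ≡ v [MOD q]) := by
  unfold cols; rfl

/-- `⌊x/A⌋/q − 1 ≤ #cols ≤ ⌊x/A⌋/q + 1`. -/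
theorem card_cols_bounds (x A : ℝ) (q v : ℕ) (hq : 0 < q) :
    (⌊x / A⌋₊ : ℝ) / q - 1 ≤ ((cols x A q v).card : ℝ) ∧
      ((cols x A q v).card : ℝ) ≤ (⌊x / A⌋₊ : ℝ) / q + 1 := by
  rw [cols_eq_Ioc]
  have := card_modEq_Ioc_bounds 0 ⌊x / A⌋₊ q v hq (Nat.zero_le _)
  simpa using this

/-- `a` itself lies in its own class of rows when `⌊A⌋ < a ≤ ⌊2A⌋`. -/
theorem self_mem_rows {A : ℝ} {q a : ℕ} (h1 : ⌊A⌋₊ < a) (h2 : a ≤ ⌊2 * A⌋₊) : a ∈ rows A q a :=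
  mem_rows.2 ⟨⟨h1, h2⟩, Nat.ModEq.refl a⟩

/-- The class of an element of the window is a nonempty row set. -/
theorem one_le_card_rows_self {A : ℝ} {q a : ℕ} (h1 : ⌊A⌋₊ < a) (h2 : a ≤ ⌊2 * A⌋₊) :
    (1 : ℝ) ≤ ((rows A q a).card : ℝ) := by
  have : 1 ≤ (rows A q a).card := Finset.card_pos.2 ⟨a, self_mem_rows h1 h2⟩
  exact_mod_cast this


/-! ## The `q = 1` block -/

/-- The `q = 1` block (any classes) is the plain table sum of `TableChowla`. -/
theorem F_one_eq_table (c : ℤ) (x A : ℝ) (u v : ℕ) :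
    F c x A 1 u v = ∑ a ∈ Finset.Ioc ⌊A⌋₊ ⌊2 * A⌋₊, ∑ a' ∈ Finset.Ioc ⌊A⌋₊ ⌊2 * A⌋₊,
      (∑ b ∈ Finset.Icc 1 ⌊x / A⌋₊, (ArithmeticFunction.liouville (Int.toNat ((a : ℤ) * b + c)) : ℝ) *
        (ArithmeticFunction.liouville (Int.toNat ((a' : ℤ) * b + c)) : ℝ)) ^ 2 := by
  unfold F S
  rw [rows_one, cols_one]
  rfl

/-! ## §11 (k') NECESSITY by Markov: the crux forces the pointwise bound off a harmonically small set

Converse companion of §10: from `Σ_q q³F_q ≤ R := x²/(log x)^C`, for every `K > 0` the dilations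
with `q⁴ F_q > K·R` have harmonic mass `Σ 1/q ≤ 1/K` (`crux_imp_pointwise_markov`). So, up to the
powers of `log x` lost between the two directions, the crux IS a "pointwise bound outside a
harmonically-sparse exceptional set of dilations" statement. -/

/-- (k') **Markov necessity**: under the crux, for every `K > 0` the dilations `q ≤ x^{δ/2}` with `q⁴ F(q,u q,v q) > K · x²/(log x)^C` have harmonic mass `Σ 1/q ≤ 1/K`. -/
theorem crux_imp_pointwise_markov (h : DilatedTableChowla) :
    ∀ c : ℤ, c ≠ 0 → ∀ δ : ℝ, 0 < δ → δ ≤ 1 / 12 → ∀ C : ℝ, 0 < C → ∃ x₀ : ℝ, ∀ x : ℝ, x₀ ≤ x →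
      ∀ A : ℝ, x ^ δ ≤ A → A ≤ x ^ (1 / 3 + δ) → ∀ u v : ℕ → ℕ, ∀ K : ℝ, 0 < K →
        (∑ q ∈ (Finset.Icc 1 ⌊x ^ (δ / 2)⌋₊).filter
            (fun q : ℕ => K * (x ^ 2 / Real.log x ^ C) < (q : ℝ) ^ 4 * F c x A q (u q) (v q)),
          ((q : ℝ))⁻¹) ≤ K⁻¹ := by
  rw [crux_iff_lhs] at h
  intro c hc δ hδ hδ' C hC
  obtain ⟨x₀, hx₀⟩ := h c hc δ hδ hδ' C hC
  refine ⟨max x₀ 3, fun x hx A hA1 hA2 u v K hK => ?_⟩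
  have hx0 : x₀ ≤ x := le_trans (le_max_left _ _) hx
  have hx3 : (3 : ℝ) ≤ x := le_trans (le_max_right _ _) hx
  have hlog : 0 < Real.log x := Real.log_pos (by linarith)
  have hR : 0 < x ^ 2 / Real.log x ^ C := div_pos (by positivity) (Real.rpow_pos_of_pos hlog C)
  set R : ℝ := x ^ 2 / Real.log x ^ C with hRdef
  set E := (Finset.Icc 1 ⌊x ^ (δ / 2)⌋₊).filter
    (fun q : ℕ => K * R < (q : ℝ) ^ 4 * F c x A q (u q) (v q)) with hE
  have key := hx₀ x hx0 A hA1 hA2 u v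
  have hsum : K * R * ∑ q ∈ E, ((q : ℝ))⁻¹ ≤ lhs c δ x A u v := by
    rw [Finset.mul_sum]
    unfold lhs
    calc ∑ q ∈ E, K * R * ((q : ℝ))⁻¹ ≤ ∑ q ∈ E, (q : ℝ) ^ 3 * F c x A q (u q) (v q) := by
          refine Finset.sum_le_sum fun q hq => ?_
          obtain ⟨hq, hqK⟩ := Finset.mem_filter.1 hq
          obtain ⟨hq1, -⟩ := Finset.mem_Icc.1 hq
          have hqpos : (0 : ℝ) < q := by exact_mod_cast hq1
          have : (q : ℝ) ^ 3 * F c x A q (u q) (v q) = ((q : ℝ))⁻¹ * ((q : ℝ) ^ 4 * F c x A q (u q) (v q)) := by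
            field_simp
          rw [this, mul_comm (K * R)]
          gcongr
      _ ≤ ∑ q ∈ Finset.Icc 1 ⌊x ^ (δ / 2)⌋₊, (q : ℝ) ^ 3 * F c x A q (u q) (v q) :=
          Finset.sum_le_sum_of_subset_of_nonneg (Finset.filter_subset _ _)
            fun q _ _ => term_nonneg c x A q (u q) (v q)
  have this : K * R * ∑ q ∈ E, ((q : ℝ))⁻¹ ≤ R := hsum.trans key
  have hKR : 0 < K * R := mul_pos hK hR
  have h2 : ∑ q ∈ E, ((q : ℝ))⁻¹ ≤ R / (K * R) := (le_div_iff₀' hKR).2 this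
  calc ∑ q ∈ E, ((q : ℝ))⁻¹ ≤ R / (K * R) := h2
    _ = K⁻¹ := by field_simp


end Summit.Parity.GeneralizedHardyLittlewood.Theorems.DilatedTableChowla.Negative
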